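import Summits.AtomisticToContinuum.BoseEinsteinCondensation.Theorems.BECGroundStateSOSRimSqueezeDefs
import Literature.MathematicalPhysics.QuantumManyBody.BoseGasThermodynamicLimitProofs
import Literature.MathematicalPhysics.QuantumManyBody.BoseGasDirichletWall

/-!
# Route `BECGroundStateSOS`, crux `BoundaryTransferWeak` (stmt-AtomisticToContinuum-0827),
# line `rim-squeeze-monotone-coherence`: stub (D), the Dirichlet endpoint of the rim ramp

At `t = ⊤` the ramp problem on the torus of side `L'` IS the Dirichlet problem of the cube of side
`L'/2 = sideLength (8ρ') N` (`sideLength_eight_mul`): a Dirichlet state of `Λ_{L'/2}` periodises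
(`TrialState.toPeriodic`) to a state of vanishing rim term, no larger energy once `L' ≥ L'/2 + R₀`,
and the same core occupation; conversely a periodic `C¹` state of finite `⊤`-rim term vanishes a.e.
on the open rim region, hence (continuity) on it, on its closure and on its lattice translates, so
its indicator cut to `(0, L'/2)^{3N}` is a `TrialState N (L'/2)` of no larger energy, whence
`E₀^D(N, L'/2) ≤ E_⊤(N, L')`. So Dirichlet `δ`-near-minimisers periodise to ramp-`⊤`
`δ`-near-minimisers and a floor on `coreOcc v ⊤ N ρ'` is one on `condensateNumber v N (L'/2)`
(`occupation_le_maxOccupation`, `le_condensateNumber`): `stub_dirichletEndpoint`.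
-/

noncomputable section

namespace Summit.AtomisticToContinuum.BoseEinsteinCondensation.RimSqueeze

open Literature.MathematicalPhysics.QuantumManyBody.BoseGas MeasureTheory Filter Set
open scoped ENNReal NNReal ComplexConjugate Topology

namespace DirichletEndpoint

variable {N : ℕ}

/-! ### Periodicity under the whole lattice -/

/-- **A periodic trial state is periodic under the whole lattice `(L'ℤ³)^N`** (its periodicity is
stated on the generators `L' e_{i,k}`; `L'·m = Σ_{i,k} m_{ik} • L' e_{i,k}`). [folklore] -/
theorem psi_add_latticeVecN {L' : ℝ} (Ψ : PeriodicTrialState N L') (X : Config N)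
    (m : Fin N → Fin 3 → ℤ) : Ψ.ψ (X + latticeVecN L' m) = Ψ.ψ X := by
  classical
  -- periodicity under finite sums of integer multiples of the generators `L' e_{i,k}`
  have key : ∀ S : Finset (Fin N × Fin 3), Ψ.ψ (X + ∑ p ∈ S,
      (m p.1 p.2) • (Pi.single p.1 (EuclideanSpace.single p.2 L') : Config N)) = Ψ.ψ X := by
    intro S
    induction S using Finset.induction_on with
    | empty => simp
    | insert p S hp ih =>
      rw [Finset.sum_insert hp, add_comm (_ • _), ← add_assoc,
        (show Function.Periodic Ψ.ψ (Pi.single p.1 (EuclideanSpace.single p.2 L')) from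
          fun Z => Ψ.periodic Z p.1 p.2).zsmul (m p.1 p.2), ih]
  have hsum : latticeVecN L' m = ∑ p : Fin N × Fin 3,
      (m p.1 p.2) • (Pi.single p.1 (EuclideanSpace.single p.2 L') : Config N) := by
    ext j l
    simp [Finset.sum_apply, Pi.single_apply, Fintype.sum_prod_type, apply_ite, mul_comm]
  rw [hsum]
  exact key _

/-! ### Rim-vanishing periodic states -/

/-- Coordinate projections `X ↦ X_{i,k}` of configuration space are continuous. [folklore] -/
theorem continuous_coord (i : Fin N) (k : Fin 3) : Continuous fun X : Config N => X i k := by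
  fun_prop

/-- **From a vanishing rim integral to vanishing on the open rim region.** If
`∫_{cell^N} (Σ_j rimPot(x_j)) |Ψ|² = 0` then `Ψ = 0` a.e. on the open set
`U = {X ∈ (0,L')^{3N} : ∃ j k, X j k > L'/2}` (where the weight is `≥ 1`), hence, `Ψ` being
continuous and Lebesgue measure charging open sets, `Ψ = 0` on `U`. [folklore] -/
theorem vanish_open {L' : ℝ} (Ψ : PeriodicTrialState N L')
    (hI : ∫⁻ X in cellN N L', (∑ j, rimPot L' (X j)) * (‖Ψ.ψ X‖₊ : ℝ≥0∞) ^ 2 = 0)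
    (X : Config N) (hX : ∀ i k, X i k ∈ Ioo 0 L') (hjk : ∃ j k, L' / 2 < X j k) : Ψ.ψ X = 0 := by
  set U : Set (Config N) := {X | (∀ i k, X i k ∈ Ioo 0 L') ∧ ∃ j k, L' / 2 < X j k}
  have hUopen : IsOpen U := by
    rw [isOpen_iff_eventually]
    rintro Y ⟨hY1, j, k, hY2⟩
    have h1 : ∀ᶠ Z in 𝓝 Y, ∀ i k, Z i k ∈ Ioo 0 L' :=
      eventually_all.2 fun i => eventually_all.2 fun k =>
        (continuous_coord i k).continuousAt.eventually_mem (isOpen_Ioo.mem_nhds (hY1 i k))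
    have h2 : ∀ᶠ Z in 𝓝 Y, Z j k ∈ Ioi (L' / 2) :=
      (continuous_coord j k).continuousAt.eventually_mem (isOpen_Ioi.mem_nhds hY2)
    filter_upwards [h1, h2] with Z hZ1 hZ2
    exact ⟨hZ1, j, k, hZ2⟩
  have hUsub : U ⊆ cellN N L' := fun Z hZ i k => ⟨(hZ.1 i k).1.le, (hZ.1 i k).2⟩
  have hmeas : Measurable fun X : Config N => (∑ j, rimPot L' (X j)) * (‖Ψ.ψ X‖₊ : ℝ≥0∞) ^ 2 :=
    (Finset.measurable_sum _ fun j _ => (measurable_rimPot L').comp (measurable_pi_apply j)).mul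
      (measurable_normSq Ψ.contDiff.continuous)
  have haeU : ∀ᵐ X ∂(volume.restrict U), Ψ.ψ X = (fun _ => (0 : ℂ)) X := by
    filter_upwards [ae_restrict_of_ae_restrict_of_subset hUsub ((lintegral_eq_zero_iff hmeas).1 hI),
      ae_restrict_mem hUopen.measurableSet] with Z hZ hZU
    obtain ⟨j, k, hjk⟩ := hZU.2
    have hpos : rimPot L' (Z j) ≠ 0 := by
      rw [rimPot_apply, if_pos ⟨k, le_of_lt hjk⟩]
      exact one_ne_zero
    have hsum : (∑ j, rimPot L' (Z j)) ≠ 0 := fun h =>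
      hpos (Finset.sum_eq_zero_iff.1 h j (Finset.mem_univ _))
    have h0 := (mul_eq_zero.1 hZ).resolve_left hsum
    simpa using h0
  have hEq := Measure.eqOn_open_of_ae_eq haeU hUopen Ψ.contDiff.continuous.continuousOn
    continuousOn_const
  exact hEq ⟨hX, hjk⟩

/-- **Closure step.** A continuous function vanishing on the open rim region
`{X ∈ (0,L')^{3N} : ∃ j k, X j k > L'/2}` vanishes on the closed rim configurations
`{X ∈ [0,L']^{3N} : ∃ j k, X j k ≥ L'/2}`: the segment from such an `X` to the constant
configuration `3L'/4` lies in the open region. [folklore] -/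
theorem vanish_closed {L' : ℝ} (hL' : 0 < L') {ψ : Config N → ℂ} (hψ : Continuous ψ)
    (hU : ∀ X : Config N, (∀ i k, X i k ∈ Ioo 0 L') → (∃ j k, L' / 2 < X j k) → ψ X = 0)
    (X : Config N) (hX : ∀ i k, X i k ∈ Icc 0 L') (hjk : ∃ j k, L' / 2 ≤ X j k) : ψ X = 0 := by
  obtain ⟨j, k, hjk⟩ := hjk
  let P : Config N := fun _ => WithLp.toLp 2 (fun _ : Fin 3 => 3 * L' / 4)
  let g : ℝ → ℂ := fun s => ψ ((1 - s) • X + s • P)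
  have hg : Continuous g := hψ.comp (by fun_prop)
  have hcoord : ∀ (s : ℝ) (i : Fin N) (l : Fin 3),
      ((1 - s) • X + s • P) i l = (1 - s) * X i l + s * (3 * L' / 4) := by
    intro s i l
    simp [P]
  have hIoo : Ioo (0 : ℝ) 1 ⊆ {s | g s = 0} := by
    intro s hs
    have hs1 : 0 ≤ 1 - s := by linarith [hs.2]
    refine hU _ (fun i l => ?_) ⟨j, k, ?_⟩
    · rw [hcoord]
      have h1 : 0 ≤ (1 - s) * X i l := mul_nonneg hs1 (hX i l).1
      have h2 : (1 - s) * X i l ≤ (1 - s) * L' := mul_le_mul_of_nonneg_left (hX i l).2 hs1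
      have h3 : 0 < s * (3 * L' / 4) := mul_pos hs.1 (by positivity)
      have h4 : s * (3 * L' / 4) < s * L' := mul_lt_mul_of_pos_left (by linarith) hs.1
      constructor <;> linarith
    · rw [hcoord]
      have h2 : (1 - s) * (L' / 2) ≤ (1 - s) * X j k := mul_le_mul_of_nonneg_left hjk hs1
      have h4 : s * (L' / 2) < s * (3 * L' / 4) := mul_lt_mul_of_pos_left (by linarith) hs.1
      linarith
  have hcl : IsClosed {s | g s = 0} := isClosed_eq hg continuous_const
  have h0 : (0 : ℝ) ∈ {s | g s = 0} := by
    apply hcl.closure_subset_iff.2 hIoo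
    rw [closure_Ioo zero_ne_one]
    exact ⟨le_rfl, zero_le_one⟩
  simpa [g] using h0

/-- **Lattice step.** A periodic state vanishing on the closed rim configurations of the cell
vanishes on all their lattice translates. [folklore] -/
theorem vanish_lattice {L' : ℝ} (Ψ : PeriodicTrialState N L')
    (hZ : ∀ X : Config N, (∀ i k, X i k ∈ Icc 0 L') → (∃ j k, L' / 2 ≤ X j k) → Ψ.ψ X = 0)
    (X : Config N) (m : Fin N → Fin 3 → ℤ) (hX : ∀ i k, X i k + L' * m i k ∈ Icc 0 L')
    (hjk : ∃ j k, L' / 2 ≤ X j k + L' * m j k) : Ψ.ψ X = 0 := by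
  rw [← psi_add_latticeVecN Ψ X m]
  refine hZ _ (fun i k => ?_) ?_
  · simpa using hX i k
  · obtain ⟨j, k, h⟩ := hjk
    exact ⟨j, k, by simpa using h⟩

/-- **Strip step.** On the open neighbourhood `{X : ∀ i k, X i k ∈ (-L'/2, L')}` of the closed
cube `[0, L'/2]^{3N}`, a rim-vanishing periodic state vanishes off the open cube `(0, L'/2)^{3N}`
(shift the non-positive coordinates by `L'`: the point lands in the closed rim). [folklore] -/
theorem vanish_strip {L' : ℝ} (hL' : 0 < L') (Ψ : PeriodicTrialState N L')
    (hZ : ∀ X : Config N, (∀ i k, X i k ∈ Icc 0 L') → (∃ j k, L' / 2 ≤ X j k) → Ψ.ψ X = 0)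
    (X : Config N) (hX : ∀ i k, X i k ∈ Ioo (-(L' / 2)) L') (hb : X ∉ boxN N (L' / 2)) :
    Ψ.ψ X = 0 := by
  classical
  let m : Fin N → Fin 3 → ℤ := fun i k => if X i k ≤ 0 then 1 else 0
  have hm : ∀ i k, (X i k ≤ 0 → (m i k : ℝ) = 1) ∧ (0 < X i k → (m i k : ℝ) = 0) := by
    intro i k
    constructor
    · intro h
      simp [m, h]
    · intro h
      simp [m, not_le.2 h]
  have hjk : ∃ j k, X j k ≤ 0 ∨ L' / 2 ≤ X j k := by
    by_contra hcon
    push Not at hcon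
    exact hb fun j k => ⟨(hcon j k).1, (hcon j k).2⟩
  refine vanish_lattice Ψ hZ X m (fun i k => ?_) ?_
  · rcases le_or_gt (X i k) 0 with h | h
    · rw [(hm i k).1 h]
      constructor <;> linarith [(hX i k).1]
    · rw [(hm i k).2 h]
      constructor <;> linarith [(hX i k).2]
  · obtain ⟨j, k, hjk⟩ := hjk
    refine ⟨j, k, ?_⟩
    rcases le_or_gt (X j k) 0 with h | h
    · rw [(hm j k).1 h]
      linarith [(hX j k).1]
    · rw [(hm j k).2 h]
      rcases hjk with h' | h'
      · exact absurd h' (not_le.2 h)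
      · linarith

/-! ### The cut of a rim-vanishing periodic state to the Dirichlet cube of side `L'/2` -/

/-- **The cut.** A periodic `C¹` state of the torus of side `L'` vanishing on the closed rim
configurations, cut off by the indicator of the open cube `(0, L'/2)^{3N}`, is a Dirichlet trial
state of `Λ_{L'/2}` (`C¹`: it is the periodic state on the open `L'/2`-neighbourhood of the closed
cube and `0` on the open complement of the closed cube; all its cell mass sits on the cube) of no
larger energy (same gradient on the open cube, `v ≤ v^per`). [folklore] -/
theorem exists_trialState_energy_le {L' : ℝ} (hL' : 0 < L') (v : ℝ → ℝ≥0∞)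
    (Ψ : PeriodicTrialState N L')
    (hZ : ∀ X : Config N, (∀ i k, X i k ∈ Icc 0 L') → (∃ j k, L' / 2 ≤ X j k) → Ψ.ψ X = 0) :
    ∃ Φ : TrialState N (L' / 2), energy v Φ ≤ periodicEnergy v Ψ := by
  have h2 : L' / 2 ≤ L' := by linarith
  have hstrip := vanish_strip hL' Ψ hZ
  -- the cut is `C¹`
  have hC1 : ContDiff ℝ 1 ((boxN N (L' / 2)).indicator Ψ.ψ) := by
    refine contDiff_iff_contDiffAt.2 fun Y => ?_
    by_cases hY : ∀ i k, Y i k ∈ Ioo (-(L' / 2)) L'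
    · have hev : (boxN N (L' / 2)).indicator Ψ.ψ =ᶠ[𝓝 Y] Ψ.ψ := by
        have hS : ∀ᶠ X in 𝓝 Y, ∀ i k, X i k ∈ Ioo (-(L' / 2)) L' :=
          eventually_all.2 fun i => eventually_all.2 fun k =>
            (continuous_coord i k).continuousAt.eventually_mem (isOpen_Ioo.mem_nhds (hY i k))
        filter_upwards [hS] with X hX
        by_cases hXb : X ∈ boxN N (L' / 2)
        · exact indicator_of_mem hXb _
        · rw [indicator_of_notMem hXb, hstrip X hX hXb]
      exact Ψ.contDiff.contDiffAt.congr_of_eventuallyEq hev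
    · simp only [not_forall] at hY
      obtain ⟨j, k, hjk⟩ := hY
      have hev : (boxN N (L' / 2)).indicator Ψ.ψ =ᶠ[𝓝 Y] fun _ => 0 := by
        rw [mem_Ioo, not_and_or, not_lt, not_lt] at hjk
        rcases hjk with h | h
        · have hn : ∀ᶠ X in 𝓝 Y, X j k ∈ Iio 0 :=
            (continuous_coord j k).continuousAt.eventually_mem
              (isOpen_Iio.mem_nhds (show Y j k < 0 by linarith))
          filter_upwards [hn] with X hX
          exact indicator_of_notMem (fun hb => absurd (hb j k).1 (not_lt.2 (le_of_lt hX))) _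
        · have hn : ∀ᶠ X in 𝓝 Y, X j k ∈ Ioi (L' / 2) :=
            (continuous_coord j k).continuousAt.eventually_mem
              (isOpen_Ioi.mem_nhds (show L' / 2 < Y j k by linarith))
          filter_upwards [hn] with X hX
          exact indicator_of_notMem (fun hb => absurd (hb j k).2 (not_lt.2 (le_of_lt hX))) _
      exact contDiffAt_const.congr_of_eventuallyEq hev
  -- its square modulus is the cell mass of `Ψ` (carried by the open cube)
  have hind : ∀ X, ((‖(boxN N (L' / 2)).indicator Ψ.ψ X‖₊ : ℝ≥0∞) ^ 2) =
      (boxN N L').indicator (fun X => (‖Ψ.ψ X‖₊ : ℝ≥0∞) ^ 2) X := by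
    intro X
    by_cases hX : X ∈ boxN N (L' / 2)
    · rw [indicator_of_mem hX, indicator_of_mem (boxN_subset_boxN h2 hX)]
    · rw [indicator_of_notMem hX]
      by_cases hX' : X ∈ boxN N L'
      · rw [indicator_of_mem hX',
          hstrip X (fun i k => ⟨by linarith [(hX' i k).1], (hX' i k).2⟩) hX]
      · rw [indicator_of_notMem hX']
        simp
  let Φ : TrialState N (L' / 2) :=
    { ψ := (boxN N (L' / 2)).indicator Ψ.ψ
      contDiff := hC1
      eq_zero := fun X hX => indicator_of_notMem hX _
      symm := by
        intro σ X
        have hmem : X ∘ σ ∈ boxN N (L' / 2) ↔ X ∈ boxN N (L' / 2) :=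
          ⟨fun h i => by simpa using h (σ.symm i), fun h i => h (σ i)⟩
        by_cases hX : X ∈ boxN N (L' / 2)
        · rw [indicator_of_mem hX, indicator_of_mem (hmem.2 hX), Ψ.symm]
        · rw [indicator_of_notMem hX, indicator_of_notMem (fun h => hX (hmem.1 h))]
      norm_eq := by
        simp_rw [hind]
        rw [lintegral_indicator (measurableSet_boxN N L'),
          setLIntegral_congr (boxN_ae_eq_cellN N L')]
        exact Ψ.norm_eq }
  refine ⟨Φ, ?_⟩
  -- energy: the integrand lives on the open cube, where the cut has the gradient of `Ψ`
  have hsupp : Function.support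
      (fun X => kineticDensity Φ.ψ X + interaction v X * (‖Φ.ψ X‖₊ : ℝ≥0∞) ^ 2) ⊆
        boxN N (L' / 2) := by
    intro X hX
    by_contra h
    apply hX
    simp [kineticDensity, Φ.fderiv_eq_zero h, Φ.eq_zero X h]
  unfold energy periodicEnergy
  rw [← setLIntegral_eq_of_support_subset hsupp]
  calc ∫⁻ X in boxN N (L' / 2), kineticDensity Φ.ψ X + interaction v X * (‖Φ.ψ X‖₊ : ℝ≥0∞) ^ 2
      ≤ ∫⁻ X in boxN N (L' / 2), kineticDensity Ψ.ψ X +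
          periodicInteraction v L' X * (‖Ψ.ψ X‖₊ : ℝ≥0∞) ^ 2 := by
        refine setLIntegral_mono' (measurableSet_boxN N _) fun X hX => ?_
        have hev : Φ.ψ =ᶠ[𝓝 X] Ψ.ψ := by
          filter_upwards [boxN_mem_nhds hX] with Y hY
          exact indicator_of_mem hY _
        have hk : kineticDensity Φ.ψ X = kineticDensity Ψ.ψ X := by
          unfold kineticDensity
          rw [hev.fderiv_eq]
        rw [hk, show Φ.ψ X = Ψ.ψ X from indicator_of_mem hX _]
        gcongr
        exact interaction_le_periodicInteraction v L' X
    _ ≤ _ := lintegral_mono_set (boxN_subset_cellN h2)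

/-- **`E₀^D(N, L'/2) ≤ E_⊤(N, L')`**: the Dirichlet ground-state energy of the cube of side `L'/2`
is at most the ground-state energy of the `t = ⊤` ramp problem on the torus of side `L'`. A
periodic state of positive rim mass has ramp energy `⊤`; one of vanishing rim mass vanishes on the
closed rim configurations and is cut to a Dirichlet trial state of no larger energy. [folklore] -/
theorem groundStateEnergy_half_le_rampGroundStateEnergy (v : ℝ → ℝ≥0∞) {L' : ℝ} (hL' : 0 < L')
    (N : ℕ) : groundStateEnergy v N (L' / 2) ≤ rampGroundStateEnergy v (rimPot L') ⊤ N L' := by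
  refine le_iInf fun Ψ => ?_
  by_cases hI : ∫⁻ X in cellN N L', (∑ j, rimPot L' (X j)) * (‖Ψ.ψ X‖₊ : ℝ≥0∞) ^ 2 = 0
  · obtain ⟨Φ, hΦ⟩ := exists_trialState_energy_le hL' v Ψ
      (vanish_closed hL' Ψ.contDiff.continuous (vanish_open Ψ hI))
    exact (groundStateEnergy_le_energy v Φ).trans
      (hΦ.trans (periodicEnergy_le_rampEnergy v _ ⊤ Ψ))
  · refine le_top.trans_eq ?_
    rw [rampEnergy, rimEnergy, ENNReal.top_mul hI, add_top]

/-! ### The periodisation of a Dirichlet state of the half cube -/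

/-- The periodisation of a Dirichlet trial state of `Λ_ℓ`, `2ℓ ≤ L'`, has vanishing rim term at
every coupling: on the cell it is the Dirichlet state, whose support `(0,ℓ)^{3N}` misses the rim
`{∃ k, x_k ≥ L'/2}`. [folklore] -/
theorem rimEnergy_toPeriodic {ℓ L' : ℝ} (hL' : 0 < L') (hℓ : ℓ ≤ L') (h2 : 2 * ℓ ≤ L')
    (Φ : TrialState N ℓ) (t : ℝ≥0∞) : rimEnergy (rimPot L') t (Φ.toPeriodic hL' hℓ) = 0 := by
  unfold rimEnergy
  rw [← setLIntegral_congr (boxN_ae_eq_cellN N L'),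
    setLIntegral_congr_fun (measurableSet_boxN N L') (g := fun _ => 0) ?_]
  · simp
  · intro X hX
    show (∑ j, rimPot L' (X j)) * (‖periodize L' Φ.ψ X‖₊ : ℝ≥0∞) ^ 2 = 0
    rw [periodize_of_mem_cellN hL' Φ.ψ (boxN_subset_cellN le_rfl hX)]
    by_cases hb : X ∈ boxN N ℓ
    · have hsum : ∑ j, rimPot L' (X j) = 0 := by
        refine Finset.sum_eq_zero fun j _ => ?_
        rw [rimPot_apply, if_neg]
        rintro ⟨k, hk⟩
        linarith [(hb j k).2]
      rw [hsum, zero_mul]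
    · rw [Φ.eq_zero X hb]
      simp

/-- On the cell, the periodisation of a Dirichlet trial state of `Λ_ℓ ⊆ [0,L')³` is the state
itself; off the cell both the cell cut-off and the state vanish. [folklore] -/
theorem indicator_cellN_toPeriodic {ℓ L' : ℝ} (hL' : 0 < L') (hℓ : ℓ ≤ L') (Φ : TrialState N ℓ) :
    (cellN N L').indicator (Φ.toPeriodic hL' hℓ).ψ = Φ.ψ := by
  funext X
  by_cases hX : X ∈ cellN N L'
  · rw [indicator_of_mem hX]
    exact periodize_of_mem_cellN hL' Φ.ψ hX
  · rw [indicator_of_notMem hX, Φ.eq_zero X fun h => hX (boxN_subset_cellN hℓ h)]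

/-! ### From the `t = ⊤` core floor to the Dirichlet condensate number -/

/-- **A core floor at `t = ⊤` is a floor on the Dirichlet condensate number of the half cube**
(`L' ≥ 2R₀`): every Dirichlet `δ`-near-minimiser `Φ` of `Λ_{L'/2}` periodises to a ramp-`⊤`
`δ`-near-minimiser (rim term `0`, `periodicEnergy ≤ energy Φ ≤ E₀^D + δ ≤ E_⊤ + δ`) whose core
occupation is `occupation N (coreMode L') Φ.ψ ≤ maxOccupation N Φ.ψ`. [folklore] -/
theorem le_condensateNumber_half {v : ℝ → ℝ≥0∞} {R₀ : ℝ} (hv : ∀ r, R₀ < r → v r = 0) {L' : ℝ}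
    (hL' : 0 < L') (hR : 2 * R₀ ≤ L') {m δ : ℝ≥0∞} (hδ : 0 < δ)
    (hm : m ≤ ⨅ (Ψ : PeriodicTrialState N L')
      (_ : rampEnergy v (rimPot L') ⊤ Ψ ≤ rampGroundStateEnergy v (rimPot L') ⊤ N L' + δ),
        cellOccupation N L' (coreMode L') Ψ.ψ) :
    m ≤ condensateNumber v N (L' / 2) := by
  refine le_condensateNumber v hδ fun Φ hΦ => ?_
  have h2 : L' / 2 ≤ L' := by linarith
  have hramp : rampEnergy v (rimPot L') ⊤ (Φ.toPeriodic hL' h2) ≤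
      rampGroundStateEnergy v (rimPot L') ⊤ N L' + δ :=
    calc rampEnergy v (rimPot L') ⊤ (Φ.toPeriodic hL' h2)
        = periodicEnergy v (Φ.toPeriodic hL' h2) := by
          rw [rampEnergy, rimEnergy_toPeriodic hL' h2 (by linarith) Φ, add_zero]
      _ ≤ energy v Φ := Φ.periodicEnergy_toPeriodic_le hv hL' h2 (by linarith)
      _ ≤ groundStateEnergy v N (L' / 2) + δ := hΦ
      _ ≤ rampGroundStateEnergy v (rimPot L') ⊤ N L' + δ :=
          add_le_add (groundStateEnergy_half_le_rampGroundStateEnergy v hL' N) le_rfl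
  calc m ≤ _ := hm
    _ ≤ cellOccupation N L' (coreMode L') (Φ.toPeriodic hL' h2).ψ :=
        iInf_cellOccupation_le v (rimPot L') ⊤ (coreMode L') _ hramp
    _ = occupation N (coreMode L') Φ.ψ := by
        rw [cellOccupation_coreMode hL', indicator_cellN_toPeriodic hL' h2 Φ]
    _ ≤ maxOccupation N Φ.ψ :=
        occupation_le_maxOccupation _ (aestronglyMeasurable_coreMode L') (lintegral_coreMode_sq hL')

/-- `sideLength (8ρ') N = sideLength ρ' N / 2`: the Dirichlet cube of side `L'/2` holds the `N`
particles at density `8ρ'` (`(N/(8ρ'))^{1/3} = (N/ρ')^{1/3}/8^{1/3}`, `8^{1/3} = 2`). [folklore] -/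
theorem sideLength_eight_mul {ρ' : ℝ} (hρ' : 0 < ρ') (N : ℕ) :
    sideLength (8 * ρ') N = sideLength ρ' N / 2 := by
  unfold sideLength
  rw [mul_comm (8 : ℝ) ρ', ← div_div, Real.div_rpow (div_nonneg N.cast_nonneg hρ'.le) (by norm_num)]
  congr 1
  rw [show (8 : ℝ) = 2 ^ ((3 : ℕ) : ℝ) by norm_num, ← Real.rpow_mul (by norm_num)]
  norm_num

end DirichletEndpoint

/-- **Stub (D) — the Dirichlet endpoint.** A floor `coreOcc v ⊤ N ρ' ≥ cN`, eventually in `N`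
(`t = ⊤` ramp problem on the torus of side `L' = sideLength ρ' N`, rim forbidden = Dirichlet cube
of side `L'/2 = sideLength (8ρ') N`), gives `HasGroundStateBEC v (8ρ')` with constant `c/2`: for
`L' ≥ 2R₀` a slack `δ > 0` with `(c/2)N <` the `δ`-level infimum exists (`lt_iSup_iff`), and
`le_condensateNumber_half` makes it `≤ condensateNumber v N (L'/2)`. [folklore] -/
theorem stub_dirichletEndpoint :
    ∀ v : ℝ → ℝ≥0∞, IsRepulsiveFiniteRange v → ∀ ρ' : ℝ, 0 < ρ' →
      (∃ c : ℝ, 0 < c ∧ ∀ᶠ N : ℕ in atTop, ENNReal.ofReal (c * N) ≤ coreOcc v ⊤ N ρ') →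
        HasGroundStateBEC v (8 * ρ') := by
  rintro v hv ρ' hρ' ⟨c, hc, hev⟩
  obtain ⟨R₀, hR₀⟩ := hv.2
  refine ⟨c / 2, half_pos hc, ?_⟩
  filter_upwards [hev, (tendsto_sideLength_atTop hρ').eventually_ge_atTop (2 * R₀),
    eventually_gt_atTop 0] with N hN hNR hN0
  have hL' : 0 < sideLength ρ' N := sideLength_pos_of_pos hρ' hN0
  have hNpos : (0 : ℝ) < N := Nat.cast_pos.2 hN0
  have hlt : ENNReal.ofReal (c / 2 * N) < coreOcc v ⊤ N ρ' :=
    lt_of_lt_of_le ((ENNReal.ofReal_lt_ofReal_iff (by positivity)).2 (by nlinarith)) hN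
  obtain ⟨δ, hδ⟩ := lt_iSup_iff.1 hlt
  obtain ⟨hδpos, hlt'⟩ := lt_iSup_iff.1 hδ
  rw [DirichletEndpoint.sideLength_eight_mul hρ' N]
  exact DirichletEndpoint.le_condensateNumber_half hR₀ hL' hNR hδpos hlt'.le

end Summit.AtomisticToContinuum.BoseEinsteinCondensation.RimSqueeze

end
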